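import Mathlib
import Summits.MatrixMultiplication.MatrixMultiplication.Theorems.FidelityWitnessesFidelityGapThreeSeventeenStubFatBorderApolarityForms
import Summits.MatrixMultiplication.MatrixMultiplication.Theorems.FidelityWitnessesFidelityGapThreeSeventeenPunctualDefs

/-!
# Borel-fixed border apolarity at `(⟨3,3,3⟩, 17)` — part 9: subspaces stable under a diagonal
# operator are stable under every function of it (torus part of "Lie-stable ⇒ group-stable")

Crux `stmt-MatrixMultiplication-4958` (`FidelityWitnesses.FidelityGapThreeSeventeen`), line
`punctual-saturation`, stub `stub_borelFixedApolarity` (helper file for the Borel normal form half).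

In the Cox ring `S`, let `L` act diagonally on monomials, `L (x^d) = c(d) · x^d` (an infinitesimal torus
generator: `c(d) = ⟨w, d⟩`), and let `L'` act by `L' (x^d) = g (c d) · x^d` for an arbitrary function
`g` (a torus ELEMENT: `g z = t^z`).  **A subspace `W` of a piece `S_D` stable under `L` is stable under
`L'`** (`TorusStable.mem_of_diag`): on the finitely many monomials of weight `D`, `g` agrees with a
Lagrange interpolation polynomial `p` of the finitely many values `c(d)`, and `p(L) W ⊆ W`.  This is
the torus part of the passage from stability under the Borel LIE ALGEBRA (the output of the limit
technology) to stability under the Borel GROUP (`IsBorelStable`).  Registered sub-goal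
`stub_borelFixedApolarity_torusStable`.  Everything proved.
-/

noncomputable section

namespace Summit.MatrixMultiplication.MatrixMultiplication.Theorems.PunctualSaturation

-- single-conjunct summit: the `Summit.<S>.<P>` prefix repeats `MatrixMultiplication` by design (D-0017)
set_option linter.dupNamespace false

open scoped BigOperators Polynomial
open MvPolynomial
open Summit.MatrixMultiplication.MatrixMultiplication.Theorems.SymbolicSquare.FatBorder

namespace TorusStable

variable (c : (Var →₀ ℕ) → ℂ) (g : ℂ → ℂ) (L L' : S →ₗ[ℂ] S)

/-- A subspace stable under `L` is stable under every polynomial in `L`. [folklore] -/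
theorem aeval_mem {W : Submodule ℂ S} (hW : ∀ f ∈ W, L f ∈ W) (p : ℂ[X]) {f : S} (hf : f ∈ W) :
    Polynomial.aeval L p f ∈ W := by
  induction p using Polynomial.induction_on' with
  | add p q hp hq => rw [map_add, LinearMap.add_apply]; exact W.add_mem hp hq
  | monomial n a =>
    rw [← Polynomial.C_mul_X_pow_eq_monomial, map_mul, map_pow, Polynomial.aeval_C,
      Polynomial.aeval_X, Module.End.mul_apply, Module.algebraMap_end_apply]
    refine W.smul_mem a ?_
    induction n with
    | zero => simpa using hf
    | succ n ih => rw [pow_succ', Module.End.mul_apply]; exact hW _ ih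

/-- A polynomial in a diagonal operator is diagonal, with eigenvalues the values of the polynomial.
[folklore] -/
theorem aeval_monomial (hL : ∀ d a, L (monomial d a) = c d • monomial d a) (p : ℂ[X])
    (d : Var →₀ ℕ) (a : ℂ) : Polynomial.aeval L p (monomial d a) = p.eval (c d) • monomial d a :=
  Module.End.aeval_apply_of_mem_apply_eq_smul (hL d a)

/-- **Stability under a diagonal operator implies stability under every function of it**, for
subspaces of one piece `S_D`. [folklore] -/
theorem mem_of_diag (hL : ∀ d a, L (monomial d a) = c d • monomial d a)
    (hL' : ∀ d a, L' (monomial d a) = g (c d) • monomial d a) {D : Fin 3 → ℕ} {W : Submodule ℂ S}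
    (hWD : W ≤ SD D) (hW : ∀ f ∈ W, L f ∈ W) {f : S} (hf : f ∈ W) : L' f ∈ W := by
  classical
  have hw : ∀ v : Var, ∑ l, wt v l = 1 := fun v => by simp [wt]
  -- interpolate `g` on the finitely many eigenvalues met in weight `D`
  set s : Finset ℂ := Finset.univ.image fun d : Mon wt D => c d.1 with hs
  set p : ℂ[X] := Lagrange.interpolate s id (fun z => g z) with hp
  have hpz : ∀ d : Mon wt D, p.eval (c d.1) = g (c d.1) := fun d => by
    have h := Lagrange.eval_interpolate_at_node (s := s) (v := id) (fun z => g z)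
      (fun _ _ _ _ h => h) (Finset.mem_image.2 ⟨d, Finset.mem_univ _, rfl⟩)
    simpa [hp] using h
  -- `L' = p(L)` on `S_D`
  have hfe : f = ∑ d : Mon wt D, monomial d.1 (coeff d.1 f) := (form_coeff wt D hw (hWD hf)).symm
  have hL'f : L' f = Polynomial.aeval L p f := by
    conv_lhs => rw [hfe]
    conv_rhs => rw [hfe]
    simp only [map_sum]
    refine Finset.sum_congr rfl fun d _ => ?_
    rw [hL', aeval_monomial c L hL, hpz]
  rw [hL'f]
  exact aeval_mem L hW p hf

end TorusStable

/-- **Registered sub-goal `stub_borelFixedApolarity_torusStable` of `stub_borelFixedApolarity`**: a subspace of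
a piece `S_D` stable under an operator diagonal on monomials is stable under every function of it (torus
part of Lie-stable ⇒ group-stable). [folklore] -/
theorem stub_borelFixedApolarity_torusStable :
    ∀ (c : (Var →₀ ℕ) → ℂ) (g : ℂ → ℂ) (L L' : S →ₗ[ℂ] S),
      (∀ d a, L (MvPolynomial.monomial d a) = c d • MvPolynomial.monomial d a) →
      (∀ d a, L' (MvPolynomial.monomial d a) = g (c d) • MvPolynomial.monomial d a) →
      ∀ (D : Fin 3 → ℕ) (W : Submodule ℂ S), W ≤ SD D → (∀ f ∈ W, L f ∈ W) → ∀ f ∈ W, L' f ∈ W :=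
  fun c g L L' hL hL' _ _ hWD hW _ hf => TorusStable.mem_of_diag c g L L' hL hL' hWD hW hf

end Summit.MatrixMultiplication.MatrixMultiplication.Theorems.PunctualSaturation

end
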